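import Summits.BirchSwinnertonDyer.BirchSwinnertonDyer.Theorems.PrintCFramBottomClassIndexLawFiveLeBorelGrossSurjectivityTower
import Summits.BirchSwinnertonDyer.BirchSwinnertonDyer.Theorems.PrintCFramBottomClassIndexLawFiveLeBorelUniserialLeaf
import Literature.NumberTheory.EllipticCurves.HeegnerPointsKolyvaginConjugation
import HarnessLib

/-!
# Route `PrintCFram`, crux C2 `BottomClassIndexLawFiveLe` (stmt-BirchSwinnertonDyer-20372), line
# `eisenstein-resource-bdp-line` (S2 `stub_kolyvaginUpper_borelCM_pairSum`, input (γ) at level `p^M`):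
# **McCallum (2) for `𝒪_𝔭`-modules of classes at the Borel CM prime, ON THE LEAF** — every
# `t ∈ ∏ W(K̄'')[𝔭^{eᵢ}]` is a joint evaluation `([xᵢ, ρ])ᵢ`, for every number field `K''` of
# degree `< p` and every level `p^M`
# (cell `bsd-print-cfram`, seat `bsd-line-cfram-p1-w2` g5; helper `--supports` 20372; 0 facts, 0 defs)

HONEST FRAMING. Nothing about BSD is proved here, and nothing of S2 itself. File 8e feeds the
`𝔭`-adic tower theorem `eq_pi_ker_of_stable_of_indep_top` of `…BorelGrossSurjectivityTower` (8d)
with `π = √−p` restricted to `W(ℚ̄)[p^M]` (`# ker π = p`, `…BorelOStructure.natCard_ker_eq`) and the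
joint range of Kolyvagin evaluations (`jointRangeN`, the tree) pulled back along
`θ = RatClosure.torsionEquiv : W(ℚ̄)[p^M] ≃ W(K̄'')[p^M]`:
* `exists_pow_smul_eq_of_smul_eq` (`(a + bμ)ⁿ = A + Bμ` on `W[p^M]` with `A ≡ aⁿ`,
  `B ≡ n aⁿ⁻¹ b (mod p)`), `exists_restrict_smul_eq_nonScalar_pow` (for `[K'' : ℚ] < p`, `M ≥ 1`:
  some `g ∈ Γ_{K''}` acts on `W[p^M]` as `A + Bμ` with `p ∤ B` — a power of w4 g3's non-scalar
  Frobenius fixing `√−p`), whence the pulled-back joint range is `μ`-STABLE (`B` is a unit mod `p^M`);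
* END STATE **`exists_h1Eval_eq_pow_of_cmRamified`**: `W/ℚ` CM, `p ≥ 5` CM-ramified, `μ = √−p`
  commuting with the `√−p`-fixing Galois elements (`exists_sqrt_end_of_cmRamified`), `[K'' : ℚ] < p`,
  `M ≥ 1`; classes `xᵢ ∈ H¹(K'', W[p^M])` (`i ∈ ι` finite) with evaluations killed by `μ^{eᵢ}` and
  TOP-LAYER independent (`∑ cᵢ μ^{eᵢ−1}(θ⁻¹[xᵢ, ρ]) = 0 ∀ ρ ∈ Γ_{K''(W[p^M])} ⟹ p ∣ cᵢ`, `eᵢ > 0`)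
  ⟹ every `t` with `μ^{eᵢ}(θ⁻¹ tᵢ) = 0` is `([xᵢ, ρ])ᵢ` for some `ρ ∈ Γ_{K''(W[p^M])}` — McCallum's
  `Gal(L_C/L) ⥲ Hom_𝒪(C, W[p^M]) = ∏ W[𝔭^{eᵢ}]` for `C ≅ ⊕ 𝒪/𝔭^{eᵢ}`, with NO image hypothesis
  (replaces `exists_h1Eval_eq_of_indep`, which needs `E[p]` simple with scalar commutant).
THEOREMS ONLY; no definition, no named fact, no `sorry`. BSD is not proved by any of this; no summit
statement is proved by this seat.
References: [McCallumLMS1991] §3 (2); [GrossLMS1991] Prop. 9.3; [Rubin1999] Prop. 5.4, Cor. 5.5.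
-/

set_option autoImplicit false
-- `…BirchSwinnertonDyer.BirchSwinnertonDyer.Theorems…` is the problem's mandated namespace (D-0017).
set_option linter.dupNamespace false

noncomputable section

open scoped Classical

namespace Summit.BirchSwinnertonDyer.BirchSwinnertonDyer.Theorems.PrintCFram.BorelKolyvaginPairing

open WeierstrassCurve Field Literature.NumberTheory.EllipticCurves
  Literature.NumberTheory.EllipticCurves.KolyvaginPairing Literature.NumberTheory.GaloisRepresentations
  Literature.NumberTheory.EllipticCurves.Rank1Residual
  Summit.BirchSwinnertonDyer.BirchSwinnertonDyer.Theorems.PrintCFram.BorelHomothety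
  Summit.BirchSwinnertonDyer.BirchSwinnertonDyer.Theorems.PrintCFram.BorelNonScalar

/-! ## §1 A non-scalar `A + Bμ`, `p ∤ B`, in `res Γ_{K''}` at every level `p^M` -/

section LeafPow

variable (W : WeierstrassCurve ℚ) [W.IsElliptic] (p : ℕ) [hp : Fact p.Prime]

omit [W.IsElliptic] hp in
/-- **Powers of `a + bμ` at level `p^M`.** If `g` commutes with `μ` (`μ² = m`, `p ∣ m`) and acts on
`W[p^M]` as `a + bμ`, then `gⁿ` acts as `A + Bμ` with `A ≡ aⁿ`, `B ≡ n aⁿ⁻¹ b (mod p)`. [folklore] -/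
theorem exists_pow_smul_eq_of_smul_eq {μ : AddMonoid.End W.geomPoints} {m : ℤ}
    (hμμ : ∀ P, μ (μ P) = m • P) (hm : m.natAbs = p) {M : ℕ} {g : absoluteGaloisGroup ℚ}
    (hg : ∀ P, μ (g • P) = g • μ P) {a b : ℤ}
    (hab : ∀ P ∈ W.geomTorsion ((p ^ M : ℕ) : ℤ), g • P = a • P + b • μ P) (n : ℕ) :
    ∃ A B qa qb : ℤ, A = a ^ n + p * qa ∧ B = n * a ^ (n - 1) * b + p * qb ∧
      ∀ P ∈ W.geomTorsion ((p ^ M : ℕ) : ℤ), g ^ n • P = A • P + B • μ P := by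
  obtain ⟨t, ht⟩ : (p : ℤ) ∣ m := Int.natCast_dvd.mpr (by rw [hm])
  induction n with
  | zero => exact ⟨1, 0, 0, 0, by simp, by simp, fun P _ => by simp⟩
  | succ n ih =>
    obtain ⟨A, B, qa, qb, hA, hB, hact⟩ := ih
    have hna : (n : ℤ) * a ^ (n - 1) * b * a = n * a ^ n * b := by
      rcases Nat.eq_zero_or_pos n with rfl | hn
      · simp
      · obtain ⟨k, rfl⟩ := Nat.exists_eq_add_of_le' hn
        rw [Nat.add_sub_cancel, pow_succ]; ring
    refine ⟨A * a + B * b * m, A * b + B * a, qa * a + B * b * t, qa * b + qb * a, ?_, ?_,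
      fun P hP => ?_⟩
    · rw [hA, ht]; ring
    · rw [hA, hB, Nat.add_sub_cancel, Nat.cast_add, Nat.cast_one]
      linear_combination hna
    · rw [pow_succ', mul_smul, hact P hP, smul_add, smul_comm g A P, smul_comm g B (μ P), ← hg,
        hab P hP, map_add, map_zsmul, map_zsmul, hμμ]
      module

/-- **A non-scalar `A + Bμ`, `p ∤ B`, in `res(Γ_{K''})` on `W[p^M]`** for every number field `K''`
with `[K'' : ℚ] < p` and every `M ≥ 1`: a power `σⁿ` (`0 < n ≤ [K'' : ℚ]`) of the non-scalar
Frobenius `σ = a + bμ` fixing `√−p` (`BorelNonScalar.exists_frobenius_nonScalar_of_cmRamified`,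
`p ∤ ab`), `B ≡ n aⁿ⁻¹ b ≢ 0 (mod p)`. [cite: Rubin1999, Cor. 5.5] [cite: GrossLMS1991, §9] -/
theorem exists_restrict_smul_eq_nonScalar_pow (hCM : W.HasCM) (h5 : 5 ≤ p) (hram : CMRamified W p)
    {s : AlgebraicClosure ℚ} {μ : AddMonoid.End W.geomPoints} {m : ℤ}
    (hs : s ^ 2 = ((-(p : ℤ) : ℤ) : AlgebraicClosure ℚ)) (hm : m.natAbs = p)
    (hμμ : ∀ P, μ (μ P) = m • P) (hcomm : ∀ g : absoluteGaloisGroup ℚ, g • s = s → ∀ P, μ (g • P) = g • μ P)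
    (K : Type) [Field K] [NumberField K] (hK : Module.finrank ℚ K < p) {M : ℕ} (hM : 1 ≤ M) :
    ∃ (g : absoluteGaloisGroup K) (A B : ℤ), ¬ (p : ℤ) ∣ B ∧
      ∀ P ∈ W.geomTorsion ((p ^ M : ℕ) : ℤ), absGaloisRestrict ℚ K g • P = A • P + B • μ P := by
  have hpr : p.Prime := hp.out
  have hp' : _root_.Prime (p : ℤ) := Nat.prime_iff_prime_int.mp hpr
  have hne := exists_mem_geomTorsion_apply_ne_zero W p hμμ hm
  have hle1 : W.geomTorsion (p : ℤ) ≤ W.geomTorsion ((p ^ M : ℕ) : ℤ) :=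
    W.geomTorsion_le_of_dvd (by exact_mod_cast dvd_pow_self p (by omega : M ≠ 0))
  obtain ⟨σ, hσs, hσ⟩ := exists_frobenius_nonScalar_of_cmRamified p W hCM h5 hram hs
  -- `σ = a + b μ` on `W[p^M]`
  obtain ⟨a, b, hab⟩ := smul_eq_smul_add_smul_of_comm W p hμμ hm hne hM (hcomm σ hσs)
  -- `p ∤ b`: otherwise `σ` is the scalar `a` on `W[p]`
  have hb : ¬ (p : ℤ) ∣ b := by
    rintro ⟨c, rfl⟩
    obtain ⟨Q, hQ⟩ := hσ a
    apply hQ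
    apply Subtype.ext
    have hpμQ : (p : ℤ) • μ (Q : W.geomPoints) = 0 := by
      rw [← map_zsmul, (show (p : ℤ) • (Q : W.geomPoints) = 0 from Q.2), map_zero]
    change σ • (Q : W.geomPoints) = ((a • Q : W.geomTorsion (p : ℤ)) : W.geomPoints)
    rw [AddSubgroupClass.coe_zsmul, hab Q (hle1 Q.2), mul_comm, mul_smul, hpμQ, smul_zero, add_zero]
  -- `p ∤ a`: otherwise `σ` kills `μ P₀ ≠ 0`
  have ha : ¬ (p : ℤ) ∣ a := by
    rintro ⟨c, rfl⟩
    obtain ⟨P₀, hP₀, hμP₀⟩ := hne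
    have hμP₀T : μ P₀ ∈ W.geomTorsion (p : ℤ) := apply_mem_torsionBy (μ : W.geomPoints →+ W.geomPoints) hP₀
    have hpμ : (p : ℤ) • μ P₀ = 0 := hμP₀T
    have h0 : σ • μ P₀ = 0 := by
      rw [hab _ (hle1 hμP₀T), mul_comm, mul_smul, hpμ, smul_zero, zero_add,
        (show μ (μ P₀) = m • P₀ from hμμ P₀), zsmul_eq_zero_of_natAbs_eq hP₀ hm, smul_zero]
    exact hμP₀ ((smul_eq_zero_iff_eq σ).mp h0)
  -- `σⁿ ∈ res(Γ_K)` with `0 < n ≤ [K : ℚ] < p`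
  have hidx : (absGaloisRestrict ℚ K).range.index = Module.finrank ℚ K :=
    index_range_absGaloisRestrict_eq_finrank ℚ K
  obtain ⟨n, hn0, hnle, hmem⟩ := Subgroup.exists_pow_mem_of_index_ne_zero
    (H := (absGaloisRestrict ℚ K).range) (by rw [hidx]; exact Module.finrank_pos.ne') σ
  rw [hidx] at hnle
  obtain ⟨g, hg⟩ := hmem
  change absGaloisRestrict ℚ K g = σ ^ n at hg
  obtain ⟨A, B, qa, qb, -, hB, hact⟩ := exists_pow_smul_eq_of_smul_eq W p hμμ hm (hcomm σ hσs) hab n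
  refine ⟨g, A, B, fun hdvd => ?_, fun P hP => by rw [hg]; exact hact P hP⟩
  -- `p ∣ B = n aⁿ⁻¹ b + p qb` is impossible
  have h : (p : ℤ) ∣ (n : ℤ) * a ^ (n - 1) * b := by
    have := dvd_sub hdvd (dvd_mul_right (p : ℤ) qb)
    rwa [hB, add_sub_cancel_right] at this
  rcases hp'.dvd_or_dvd h with h | h
  · rcases hp'.dvd_or_dvd h with h | h
    · have : p ∣ n := by exact_mod_cast h
      exact absurd (Nat.le_of_dvd hn0 this) (by omega)
    · exact ha (hp'.dvd_of_dvd_pow h)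
  · exact hb h

end LeafPow

/-! ## §2 McCallum (2) at level `p^M` on the leaf, in the machine's currency -/

section MachinePow

variable (W : WeierstrassCurve ℚ) [W.IsElliptic] (p : ℕ) [hp : Fact p.Prime]
variable (K : Type) [Field K] [NumberField K]

/-- **END STATE (γ) at level `p^M`: McCallum's (2) for `𝒪_𝔭`-modules of classes at the Borel CM
prime.** `W/ℚ` with CM, `p ≥ 5` CM-ramified, `μ = √−p ∈ End W(ℚ̄)` commuting with the `√−p`-fixing
Galois elements (`exists_sqrt_end_of_cmRamified`), `K` a number field with `[K : ℚ] < p`, `M ≥ 1`,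
`θ : W(ℚ̄)[p^M] ≃ W(K̄)[p^M]` (`RatClosure.torsionEquiv`). Let `x_i ∈ H¹(K, W[p^M])` (`i ∈ ι` finite)
have evaluations killed by `μ^{eᵢ}` and TOP-LAYER independent:
`∑ cᵢ μ^{eᵢ−1}(θ⁻¹[xᵢ, ρ]) = 0` for all `ρ ∈ Γ_{K(W[p^M])}` forces `p ∣ cᵢ` (`eᵢ > 0`). Then every
`t ∈ ∏ᵢ W(K̄)[𝔭^{eᵢ}]` (`μ^{eᵢ}(θ⁻¹ tᵢ) = 0`) is `([xᵢ, ρ])ᵢ` for some `ρ ∈ Γ_{K(W[p^M])}` — the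
isomorphism `Gal(L_C/L) ⥲ Hom_𝒪(C, W[p^M]) = ∏ W[𝔭^{eᵢ}]`. Proof: the `𝔭`-adic tower
`eq_pi_ker_of_stable_of_indep_top` for `π = μ|_{W[p^M]}` (`# ker = p`, `…BorelOStructure.natCard_ker_eq`)
and the joint range pulled back along `θ`, which is `μ`-stable because some `g ∈ Γ_K` acts as
`A + Bμ`, `p ∤ B` (`exists_restrict_smul_eq_nonScalar_pow`). No image hypothesis.
[cite: McCallumLMS1991, §3 (2)] [cite: GrossLMS1991, Prop. 9.3] [cite: Rubin1999, Prop. 5.4] -/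
theorem exists_h1Eval_eq_pow_of_cmRamified (hCM : W.HasCM) (h5 : 5 ≤ p) (hram : CMRamified W p)
    {s : AlgebraicClosure ℚ} {μ : AddMonoid.End W.geomPoints} {m : ℤ}
    (hs : s ^ 2 = ((-(p : ℤ) : ℤ) : AlgebraicClosure ℚ)) (hm : m.natAbs = p)
    (hμμ : ∀ P, μ (μ P) = m • P) (hcomm : ∀ g : absoluteGaloisGroup ℚ, g • s = s → ∀ P, μ (g • P) = g • μ P)
    (hK : Module.finrank ℚ K < p) {M : ℕ} (hM : 1 ≤ M)
    {ι : Type*} [Fintype ι] (xs : ι → galH1Torsion (W.baseChange K) ((p ^ M : ℕ) : ℤ)) (e : ι → ℕ)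
    (he : ∀ i, ∀ ρ ∈ torsionFixing (W.baseChange K) ((p ^ M : ℕ) : ℤ),
      (μ ^ e i) ((RatClosure.torsionEquiv (K := K) W ((p ^ M : ℕ) : ℤ)).symm
        (h1Eval (W.baseChange K) ((p ^ M : ℕ) : ℤ) (xs i) ρ) : W.geomPoints) = 0)
    (hind : ∀ c : ι → ℤ,
      (∀ ρ ∈ torsionFixing (W.baseChange K) ((p ^ M : ℕ) : ℤ),
        ∑ i, c i • (μ ^ (e i - 1)) ((RatClosure.torsionEquiv (K := K) W ((p ^ M : ℕ) : ℤ)).symm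
          (h1Eval (W.baseChange K) ((p ^ M : ℕ) : ℤ) (xs i) ρ) : W.geomPoints) = 0) →
        ∀ i, 0 < e i → (p : ℤ) ∣ c i)
    (t : ι → geomTorsion (W.baseChange K) ((p ^ M : ℕ) : ℤ))
    (ht : ∀ i, (μ ^ e i)
      ((RatClosure.torsionEquiv (K := K) W ((p ^ M : ℕ) : ℤ)).symm (t i) : W.geomPoints) = 0) :
    ∃ ρ ∈ torsionFixing (W.baseChange K) ((p ^ M : ℕ) : ℤ),
      ∀ i, h1Eval (W.baseChange K) ((p ^ M : ℕ) : ℤ) (xs i) ρ = t i := by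
  have hpr : p.Prime := hp.out
  have hp' : _root_.Prime (p : ℤ) := Nat.prime_iff_prime_int.mp hpr
  -- `μ` restricted to `W[p^M]`
  have hμmem : ∀ P ∈ W.geomTorsion ((p ^ M : ℕ) : ℤ), μ P ∈ W.geomTorsion ((p ^ M : ℕ) : ℤ) :=
    fun P hP => apply_mem_torsionBy (μ : W.geomPoints →+ W.geomPoints) hP
  set μM : AddMonoid.End (W.geomTorsion ((p ^ M : ℕ) : ℤ)) :=
    { toFun := fun t => ⟨μ t, hμmem _ t.2⟩
      map_zero' := Subtype.ext (by change μ (0 : W.geomPoints) = 0; exact map_zero μ)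
      map_add' := fun P Q => Subtype.ext (by
        change μ ((P : W.geomPoints) + Q) = μ P + μ Q; exact map_add μ _ _) } with hμM
  have hμMapp : ∀ t : W.geomTorsion ((p ^ M : ℕ) : ℤ),
      ((μM t : W.geomTorsion ((p ^ M : ℕ) : ℤ)) : W.geomPoints) = μ t := fun _ => rfl
  have hpow : ∀ (k : ℕ) (t : W.geomTorsion ((p ^ M : ℕ) : ℤ)),
      (((μM ^ k) t : W.geomTorsion ((p ^ M : ℕ) : ℤ)) : W.geomPoints) = (μ ^ k) (t : W.geomPoints) := by
    intro k
    induction k with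
    | zero => intro t; rfl
    | succ k ih => intro t; rw [pow_succ_apply, pow_succ_apply, hμMapp, ih]
  -- `# ker μM = p`
  have hne := exists_mem_geomTorsion_apply_ne_zero W p hμμ hm
  have hkerle : (μ : W.geomPoints →+ W.geomPoints).ker ≤ W.geomTorsion ((p ^ M : ℕ) : ℤ) :=
    (ker_le_torsionBy (μ : W.geomPoints →+ W.geomPoints) hμμ hm).trans
      (W.geomTorsion_le_of_dvd (by exact_mod_cast dvd_pow_self p (by omega : M ≠ 0)))
  have hkerM : Nat.card (AddMonoidHom.ker μM) = p := by
    have hk := natCard_ker_eq (μ : W.geomPoints →+ W.geomPoints) hμμ hm hpr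
      (W.natCard_geomTorsion_prime_eq_sq hpr) hne
    have hto : ∀ t : AddMonoidHom.ker μM,
        ((t : W.geomTorsion ((p ^ M : ℕ) : ℤ)) : W.geomPoints) ∈ (μ : W.geomPoints →+ W.geomPoints).ker := by
      intro t
      have h := t.2
      rw [AddMonoidHom.mem_ker] at h
      rw [AddMonoidHom.mem_ker]
      exact (congrArg (fun x : W.geomTorsion ((p ^ M : ℕ) : ℤ) => (x : W.geomPoints)) h).trans
        (ZeroMemClass.coe_zero _)
    have hinv : ∀ P : (μ : W.geomPoints →+ W.geomPoints).ker,
        (⟨(P : W.geomPoints), hkerle P.2⟩ : W.geomTorsion ((p ^ M : ℕ) : ℤ)) ∈ AddMonoidHom.ker μM := by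
      intro P
      have h := P.2
      rw [AddMonoidHom.mem_ker] at h
      rw [AddMonoidHom.mem_ker]
      exact Subtype.ext h
    let ε : AddMonoidHom.ker μM ≃ (μ : W.geomPoints →+ W.geomPoints).ker :=
      { toFun := fun t => ⟨_, hto t⟩
        invFun := fun P => ⟨_, hinv P⟩
        left_inv := fun t => rfl
        right_inv := fun P => rfl }
    exact (Nat.card_congr ε).trans hk
  -- the joint range, pulled back to the `ℚ̄` side along `θ`
  set θ := RatClosure.torsionEquiv (K := K) W ((p ^ M : ℕ) : ℤ) with hθ
  set Θ : (ι → W.geomTorsion ((p ^ M : ℕ) : ℤ)) →+ (ι → geomTorsion (W.baseChange K) ((p ^ M : ℕ) : ℤ)) :=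
    θ.toAddMonoidHom.compLeft ι with hΘ
  set J₀ : AddSubgroup (ι → W.geomTorsion ((p ^ M : ℕ) : ℤ)) :=
    (jointRangeN (W.baseChange K) ((p ^ M : ℕ) : ℤ) xs).comap Θ with hJ₀
  have hmemJ₀ : ∀ m₀, m₀ ∈ J₀ ↔ ∃ ρ ∈ torsionFixing (W.baseChange K) ((p ^ M : ℕ) : ℤ),
      ∀ i, h1Eval (W.baseChange K) ((p ^ M : ℕ) : ℤ) (xs i) ρ = θ (m₀ i) := fun m₀ => by
    rw [hJ₀, AddSubgroup.mem_comap, mem_jointRangeN_iff]; rfl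
  -- a non-scalar `A + Bμ` in `res Γ_K` makes `J₀` stable under `μ`
  obtain ⟨g, A, B, hB, hAB⟩ :=
    exists_restrict_smul_eq_nonScalar_pow W p hCM h5 hram hs hm hμμ hcomm K hK hM
  have hstab : ∀ m₀ ∈ J₀, (fun i => absGaloisRestrict ℚ K g • m₀ i) ∈ J₀ := by
    intro m₀ hm₀
    obtain ⟨ρ, hρ, hρm⟩ := (hmemJ₀ m₀).mp hm₀
    have hmem : (fun i => g • θ (m₀ i)) ∈ jointRangeN (W.baseChange K) ((p ^ M : ℕ) : ℤ) xs :=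
      smul_mem_jointRangeN (W.baseChange K) ((p ^ M : ℕ) : ℤ) xs g (e := fun i => θ (m₀ i)) ⟨ρ, hρ, hρm⟩
    obtain ⟨ρ', hρ', h'⟩ := hmem
    exact (hmemJ₀ _).mpr ⟨ρ', hρ', fun i => by rw [h', RatClosure.torsionEquiv_smul]⟩
  have hnM0 : ∀ t : W.geomTorsion ((p ^ M : ℕ) : ℤ), ((p ^ M : ℕ) : ℤ) • t = 0 := fun t =>
    Subtype.ext (by rw [AddSubgroupClass.coe_zsmul]; exact t.2)
  have hπ : ∀ m₀ ∈ J₀, (fun i => μM (m₀ i)) ∈ J₀ := by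
    intro m₀ hm₀
    have h1 : (fun i => absGaloisRestrict ℚ K g • m₀ i) - A • m₀ = B • fun i => μM (m₀ i) := by
      funext i
      simp only [Pi.sub_apply, Pi.smul_apply]
      apply Subtype.ext
      rw [AddSubgroupClass.coe_sub, AddSubgroupClass.coe_zsmul, AddSubgroupClass.coe_zsmul, hμMapp]
      change absGaloisRestrict ℚ K g • ((m₀ i : W.geomTorsion ((p ^ M : ℕ) : ℤ)) : W.geomPoints) - _ = _
      rw [hAB _ (m₀ i).2, add_sub_cancel_left]
    have h2 : B • (fun i => μM (m₀ i)) ∈ J₀ := by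
      rw [← h1]; exact J₀.sub_mem (hstab m₀ hm₀) (J₀.zsmul_mem hm₀ A)
    obtain ⟨u, v, huv⟩ := ((Prime.coprime_iff_not_dvd hp').mpr hB).pow_left (m := M)
    have h0 : (((p ^ M : ℕ) : ℤ) • fun i => μM (m₀ i)) = 0 := funext fun i => by
      rw [Pi.smul_apply, Pi.zero_apply]; exact hnM0 _
    have : (fun i => μM (m₀ i)) =
        v • (B • fun i => μM (m₀ i)) + u • (((p ^ M : ℕ) : ℤ) • fun i => μM (m₀ i)) := by
      rw [smul_smul, smul_smul, ← add_smul, add_comm]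
      push_cast
      rw [huv]
      exact (one_zsmul _).symm
    rw [this, h0, smul_zero, add_zero]
    exact J₀.zsmul_mem h2 v
  -- `J₀ ≤ ∏ ker μM^{eᵢ}` and the top-layer independence, from the hypotheses on the classes
  have hle : J₀ ≤ AddSubgroup.pi Set.univ (fun i => AddMonoidHom.ker (μM ^ e i)) := by
    intro m₀ hm₀
    obtain ⟨ρ, hρ, hρm⟩ := (hmemJ₀ m₀).mp hm₀
    refine (mem_pi_ker_iff μM e m₀).mpr fun i => Subtype.ext ?_
    rw [hpow, ZeroMemClass.coe_zero]
    have := he i ρ hρ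
    rwa [hρm i, θ.symm_apply_apply] at this
  have hind₀ : ∀ c : ι → ℤ, (∀ m₀ ∈ J₀, ∑ i, c i • (μM ^ (e i - 1)) (m₀ i) = 0) →
      ∀ i, 0 < e i → (p : ℤ) ∣ c i := by
    intro c hc
    refine hind c fun ρ hρ => ?_
    have hm₀J : (fun i => θ.symm (h1Eval (W.baseChange K) ((p ^ M : ℕ) : ℤ) (xs i) ρ)) ∈ J₀ :=
      (hmemJ₀ _).mpr ⟨ρ, hρ, fun i => by rw [θ.apply_symm_apply]⟩
    have h := congrArg (fun x : W.geomTorsion ((p ^ M : ℕ) : ℤ) => (x : W.geomPoints)) (hc _ hm₀J)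
    simp only [AddSubgroup.val_finsetSum, AddSubgroupClass.coe_zsmul, hpow, ZeroMemClass.coe_zero] at h
    exact h
  -- the tower theorem
  have htop := eq_pi_ker_of_stable_of_indep_top μM hpr hkerM (Finset.univ.sup e)
    (fun i => Finset.le_sup (Finset.mem_univ i)) J₀ hπ hle hind₀
  -- conclusion
  have ht₀mem : (fun i => θ.symm (t i)) ∈ J₀ := by
    rw [htop, mem_pi_ker_iff]
    intro i
    apply Subtype.ext
    rw [hpow, ZeroMemClass.coe_zero]
    exact ht i
  obtain ⟨ρ, hρ, hρt⟩ := (hmemJ₀ _).mp ht₀mem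
  exact ⟨ρ, hρ, fun i => by rw [hρt i, θ.apply_symm_apply]⟩

end MachinePow

end Summit.BirchSwinnertonDyer.BirchSwinnertonDyer.Theorems.PrintCFram.BorelKolyvaginPairing

end
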